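import Summits.NavierStokesRegularity.FluidComputer.PeriodicProfileSingularPoint
import Summits.NavierStokesRegularity.FluidComputer.DssGermAncientClassicalSolution
import HarnessLib

/-!
# The exact periodic-profile object in an arbitrary clock is the terminal piece of an ANCIENT
# discretely self-similar field — Type I in space–time when the profile decays like `1/|y|`

Summit `NavierStokesRegularity`, cell topic directory `FluidComputer`, namespace
`…FluidComputer.SelfSimilarCensus`; zone Z7 of the D-0081 profile search. Assembly of
`PeriodicProfileSingularPoint.lean` (the `P`-periodic profile `W(σ, ·)` in an ARBITRARY clock, solving
the momentum equation at the clock times, is DSS at every physical time of a terminal interval) with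
`DssGermBackwardExtension.lean` (a DSS germ extends uniquely to a global DSS field) and
`DssGermAncientClassicalSolution.lean` (the Type-I bound passes to the extension). Blow-up time
normalised to `T = 0`. PROVED theorems only; no definitions, no named facts.

## Content (standing hypotheses = `PeriodicProfileClockRigidity` §4, `θ(σ) → 0`)

* §1 `nsRescale_inv_pow_eq_of_dss_of_agree` (pure scaling, any normed spaces): a globally `c`-DSS
  field that agrees with a germ `u` on `(T₁, 0)` has the representation
  `v t = nsRescale (c⁻¹)ᵏ u t` whenever `(c⁻¹)²ᵏ t ∈ (T₁, 0)` — so `hasTypeIDecay_of_germ` applies to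
  ANY such field.
* §2 `periodicProfile_germ` — the object satisfies the germ relation `nsRescale c⁻¹ u t = u t` at
  every physical time `t ∈ (θ(σ₁), 0)`, `σ₁ > σ₀`; **`periodicProfile_exists_ancient_dss`** — there
  are `c > 1` and a GLOBAL field `ũ` with `IsDiscretelySelfSimilar c ũ` (the tree's class), equal to
  `u` at every physical time `t ∈ (θ(σ₁), 0)` for every `σ₁ > σ₀`, and `0` from the blow-up time on;
  `periodicProfile_ancient_dss_unique` — any `c`-DSS field through the object on some
  `(θ(σ₁), 0)` is determined on `t < 0`.
* §3 **`periodicProfile_typeI_spaceTime`** — if the profile decays like the Type-I class asks,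
  `‖W(σ, y)‖ ≤ K/(1 + ‖y‖)`, then `‖u(t, x)‖ ≤ K(1 + √M)/(‖x‖ + √(−t))` at every physical time of a
  terminal interval (`M` the upper gauge constant, `(−θ)ℓ² ≤ M`); **`periodicProfile_hasTypeIDecay`**
  — consequently EVERY `c`-DSS field `v` through the object (in particular `ũ`) satisfies the tree's
  `HasTypeIDecay (K(1 + √M)) v` on all of `t < 0`: the space–time Type-I hypothesis
  `∃ C₀, HasTypeIDecay C₀ u` of the `rdssClass_*` kernel floors (KNSS 2009 (1.6)).

READING for the Z7 row (lead's pen): the exact Z7 object — a DSS / log-periodically modulated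
profile in ANY clock — is, at every physical time near the blow-up, the terminal piece of a unique
ANCIENT `c`-DSS field, Type I in space–time as soon as the profile has the `1/|y|` tail; what
separates it from the hypothesis class of the (K-a) floors (`rdssClass_*`: ancient MILD, rotated-DSS,
Type I, non-trivial) is the solution FORMULATION (pointwise momentum equation at the clock times vs
the mild/duality formulation), not the self-similar structure.

WHAT THIS IS NOT: not a membership proof in `rdssClass` (no mild formulation is derived), not an
existence or non-existence claim, not Navier–Stokes evidence; «violates: none — no object».

References: G. Koch, N. Nadirashvili, G. Seregin, V. Šverák, Acta Math. 203 (2009), (1.6)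
[KochNadirashviliSereginSverak2009]; D. Chae, J. Wolf, ARMA 225 (2017), Def. 1.1
[ChaeWolf2017RemovingDSS]; J. Leray, Acta Math. 63 (1934), §20 [Leray1934].
-/

noncomputable section

open Set Filter Topology InnerProductSpace Function Metric
open scoped Laplacian RealInnerProductSpace

namespace Summit.NavierStokesRegularity.FluidComputer.SelfSimilarCensus

open Literature.Analysis.FluidPDE Literature.Analysis.FluidPDE.BradshawTsai2019

/-! ### §1 Representation of any DSS field through a germ (pure scaling) -/

section Scaling

variable {E : Type*} [NormedAddCommGroup E] [NormedSpace ℝ E]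
variable {F : Type*} [NormedAddCommGroup F] [NormedSpace ℝ F]

/-- **Any globally DSS field through a germ is the rescaled germ.** If `v` is `c`-DSS
(`nsRescale c v = v`, `c ≠ 0`) and `v t = u t` for `t ∈ (T₁, 0)`, then
`v t = nsRescale (c⁻¹)ᵏ u t` whenever `(c⁻¹)²ᵏ t ∈ (T₁, 0)` (iterate `nsRescale c⁻¹ v = v` and read
`v` inside the germ). [folklore] -/
theorem nsRescale_inv_pow_eq_of_dss_of_agree {c T₁ : ℝ} (hc : c ≠ 0) {u v : ℝ → E → F}
    (hv : IsDiscretelySelfSimilar c v) (hagree : ∀ t ∈ Ioo T₁ 0, v t = u t) (k : ℕ) (t : ℝ)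
    (ht : (c⁻¹ ^ k) ^ 2 * t ∈ Ioo T₁ 0) : v t = nsRescale (c⁻¹ ^ k) u t := by
  have hv' : nsRescale (c⁻¹ ^ k) v = v :=
    isDiscretelySelfSimilar_pow (isDiscretelySelfSimilar_inv hc hv) k
  funext x
  rw [← hv', nsRescale_apply, nsRescale_apply, hagree _ ht]

end Scaling

/-! ### §2 The periodic-profile object as an ancient DSS field -/

section PeriodicProfile

variable {E : Type*} [NormedAddCommGroup E] [InnerProductSpace ℝ E] [FiniteDimensional ℝ E]
variable {W : ℝ → E → E} {Q : ℝ → E → ℝ} {u : ℝ → E → E} {p : ℝ → E → ℝ}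
  {ℓ ℓ' θ : ℝ → ℝ} {ν P σ₀ : ℝ}

/-! Standing hypotheses = those of `PeriodicProfileClockRigidity` §4 / `PeriodicProfileSingularPoint`
§3, verbatim (open half-line `σ > σ₀`: `ℓ > 0` with derivative `ℓ′`, `θ′ = ℓ⁻²`; `P > 0`; `W`
jointly `C¹`, `P`-periodic, every slice `W(σ, ·) ≢ 0`; `Q` `P`-periodic; ansatz, pressure ansatz,
differentiability and the momentum equation at the clock times; any `ν`), with the blow-up time
normalised to `0`: `θ(σ) → 0` (hypothesis `hT` of each theorem). -/
variable (hP : 0 < P) (hℓ : ∀ σ, σ₀ < σ → HasDerivAt ℓ (ℓ' σ) σ) (hpos : ∀ σ, σ₀ < σ → 0 < ℓ σ)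
  (hθ : ∀ σ, σ₀ < σ → HasDerivAt θ ((ℓ σ ^ 2)⁻¹) σ) (hW : ContDiff ℝ 1 (uncurry W))
  (hper : ∀ s, W (s + P) = W s) (hperQ : ∀ s, Q (s + P) = Q s)
  (hW0 : ∀ σ, σ₀ < σ → W σ ≠ 0)
  (hans : ∀ σ, σ₀ < σ → ∀ x, u (θ σ) x = ℓ σ • W σ (ℓ σ • x))
  (hp : ∀ σ, σ₀ < σ → p (θ σ) = fun x => ℓ σ ^ 2 * Q σ (ℓ σ • x))
  (hu : ∀ σ, σ₀ < σ → ∀ x, DifferentiableAt ℝ (fun t => u t x) (θ σ))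
  (heq : ∀ σ, σ₀ < σ → ∀ x : E,
    timeDeriv u (θ σ) x + convect (u (θ σ)) (u (θ σ)) x + gradient (p (θ σ)) x -
      ν • (Δ (u (θ σ))) x = 0)
include hP hℓ hpos hθ hW hper hperQ hW0 hans hp hu heq

/-- **The object satisfies the germ relation at every physical time near the blow-up time**:
there is `c > 1` with `nsRescale c⁻¹ u t = u t`, i.e. `u(t, x) = c⁻¹ u(c⁻²t, c⁻¹x)`, for every
`t ∈ (θ(σ₁), 0)` and every `σ₁ > σ₀` (`periodicProfile_dss_Ioo` with `T = 0`, read at `x ↦ c⁻¹x`).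
[folklore] -/
theorem periodicProfile_germ (hT : Tendsto θ atTop (𝓝 0)) :
    ∃ c : ℝ, 1 < c ∧ ∀ σ₁, σ₀ < σ₁ → ∀ t ∈ Ioo (θ σ₁) 0, nsRescale c⁻¹ u t = u t := by
  obtain ⟨c, hc, hcov⟩ := periodicProfile_dss_Ioo hP hℓ hpos hθ hW hper hperQ hW0 hans hp hu heq hT
  have hc0 : 0 < c := zero_lt_one.trans hc
  refine ⟨c, hc, fun σ₁ hσ₁ t ht => funext fun x => ?_⟩
  have h := hcov σ₁ hσ₁ t ht (c⁻¹ • x)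
  rw [smul_smul, mul_inv_cancel₀ hc0.ne', one_smul, zero_sub, zero_sub, neg_div, neg_neg] at h
  rw [nsRescale_apply, inv_pow, ← div_eq_inv_mul, h, smul_smul, inv_mul_cancel₀ hc0.ne', one_smul]

/-- **THE OBJECT IS THE TERMINAL PIECE OF AN ANCIENT DSS FIELD.** There are `c > 1` and a field
`ũ : ℝ → E → E`, DISCRETELY SELF-SIMILAR IN THE TREE'S GLOBAL SENSE `IsDiscretelySelfSimilar c ũ`
(`nsRescale c ũ = ũ` on all of `ℝ × E`), which coincides with the object at every physical time
`t ∈ (θ(σ₁), 0)` for every `σ₁ > σ₀` and vanishes from the blow-up time on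
(`exists_dss_extension` on the germ interval `(θ(σ₀ + 1), 0)`; agreement below `θ(σ₀ + 1)` by the
representation and `nsRescale_inv_pow_eq_of_germ` on the larger germ intervals). [folklore] -/
theorem periodicProfile_exists_ancient_dss (hT : Tendsto θ atTop (𝓝 0)) :
    ∃ c : ℝ, 1 < c ∧ ∃ v : ℝ → E → E, IsDiscretelySelfSimilar c v ∧
      (∀ σ₁, σ₀ < σ₁ → ∀ t ∈ Ioo (θ σ₁) 0, v t = u t) ∧ ∀ t, 0 ≤ t → v t = 0 := by
  obtain ⟨c, hc, hgerm⟩ := periodicProfile_germ hP hℓ hpos hθ hW hper hperQ hW0 hans hp hu heq hT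
  have h1 : σ₀ < σ₀ + 1 := lt_add_one σ₀
  have hT₁ : θ (σ₀ + 1) < 0 := periodicProfile_time_lt hP hpos hθ hT h1
  obtain ⟨v, hv, -, hrep, hzero⟩ := exists_dss_extension hc hT₁ (hgerm (σ₀ + 1) h1)
  refine ⟨c, hc, v, hv, fun σ₁ hσ₁ t ht => ?_, hzero⟩
  obtain ⟨k, hk⟩ := exists_admissible_of_neg hc hT₁ ht.2
  rw [hrep k t hk]
  exact nsRescale_inv_pow_eq_of_germ hc (hgerm σ₁ hσ₁) k t ht

omit [FiniteDimensional ℝ E] hℓ hW hper hperQ hW0 hans hp hu heq in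
/-- **Uniqueness**: two `c`-DSS fields (`c > 1`) that both coincide with the object on some
`(θ(σ₁), 0)`, `σ₁ > σ₀`, agree at every `t < 0` (`dss_extension_unique`). [folklore] -/
theorem periodicProfile_ancient_dss_unique (hT : Tendsto θ atTop (𝓝 0)) {c : ℝ} (hc : 1 < c)
    {v w : ℝ → E → E} (hv : IsDiscretelySelfSimilar c v) (hw : IsDiscretelySelfSimilar c w)
    {σ₁ : ℝ} (hσ₁ : σ₀ < σ₁) (hvu : ∀ t ∈ Ioo (θ σ₁) 0, v t = u t)
    (hwu : ∀ t ∈ Ioo (θ σ₁) 0, w t = u t) : ∀ t < 0, v t = w t :=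
  dss_extension_unique hc (periodicProfile_time_lt hP hpos hθ hT hσ₁) hv hw
    fun t ht => (hvu t ht).trans (hwu t ht).symm

/-! ### §3 Space–time Type I from a `1/|y|` profile tail -/

/-- **SPACE–TIME TYPE-I BOUND FROM THE PROFILE TAIL.** If `‖W(σ, y)‖ ≤ K/(1 + ‖y‖)` for all
`σ > σ₀`, `y`, then with the upper gauge constant `M` (`(−θ(σ))ℓ(σ)² ≤ M`,
`periodicProfile_blowup_rigidity`): `‖u(t, x)‖ ≤ K(1 + √M)/(‖x‖ + √(−t))` for every physical time
`t ∈ (θ(σ₁), 0)`, `σ₁ > σ₀`, and every `x`. (At `t = θ(σ)`: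
`‖u‖ = ℓ‖W(σ, ℓx)‖ ≤ K/(ℓ⁻¹ + ‖x‖)` and `ℓ⁻¹ ≥ √(−t)/√M`.) [folklore] -/
theorem periodicProfile_typeI_spaceTime (hT : Tendsto θ atTop (𝓝 0)) {K : ℝ}
    (hK : ∀ σ, σ₀ < σ → ∀ y : E, ‖W σ y‖ ≤ K / (1 + ‖y‖)) :
    ∃ C₀ : ℝ, ∀ σ₁, σ₀ < σ₁ → ∀ t ∈ Ioo (θ σ₁) 0, ∀ x : E,
      ‖u t x‖ ≤ C₀ / (‖x‖ + Real.sqrt (-t)) := by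
  obtain ⟨c, -, -, -, hlt, -, m, M, hm, hmM, hbd⟩ :=
    periodicProfile_blowup_rigidity hP hℓ hpos hθ hW hper hperQ hW0 hans hp hu heq hT
  have h1 : σ₀ < σ₀ + 1 := lt_add_one σ₀
  have hK0 : 0 ≤ K := by
    have h := hK (σ₀ + 1) h1 0
    rw [norm_zero, add_zero, div_one] at h
    exact (norm_nonneg _).trans h
  have hM : 0 < M := hm.trans_le hmM
  refine ⟨K * (1 + Real.sqrt M), fun σ₁ hσ₁ t ht x => ?_⟩
  obtain ⟨σ, hσ, rfl⟩ := periodicProfile_exists_clockTime hθ hT hσ₁ ht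
  have hσ₀ : σ₀ < σ := hσ₁.trans hσ
  have hℓσ := hpos σ hσ₀
  have hneg : 0 < -θ σ := by linarith [hlt σ hσ₀]
  have hs : 0 < Real.sqrt (-θ σ) := Real.sqrt_pos.2 hneg
  have hden : 0 < ‖x‖ + Real.sqrt (-θ σ) := by positivity
  -- `‖u(θ σ, x)‖ ≤ K / (ℓ⁻¹ + ‖x‖)`
  have hux : ‖u (θ σ) x‖ ≤ K / ((ℓ σ)⁻¹ + ‖x‖) := by
    rw [hans σ hσ₀, norm_smul, Real.norm_of_nonneg hℓσ.le]
    have h := hK σ hσ₀ (ℓ σ • x)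
    rw [norm_smul, Real.norm_of_nonneg hℓσ.le] at h
    have hd : 0 < 1 + ℓ σ * ‖x‖ := by positivity
    calc ℓ σ * ‖W σ (ℓ σ • x)‖ ≤ ℓ σ * (K / (1 + ℓ σ * ‖x‖)) :=
          mul_le_mul_of_nonneg_left h hℓσ.le
      _ = K / ((ℓ σ)⁻¹ + ‖x‖) := by field_simp
  -- `√(−θ σ) ≤ √M ℓ⁻¹`, hence `‖x‖ + √(−θ σ) ≤ (1 + √M)(ℓ⁻¹ + ‖x‖)`
  have hgauge : Real.sqrt (-θ σ) * ℓ σ ≤ Real.sqrt M := by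
    rw [← Real.sqrt_sq hℓσ.le, ← Real.sqrt_mul hneg.le]
    exact Real.sqrt_le_sqrt (by nlinarith [(hbd σ hσ₀).2])
  have hcmp : ‖x‖ + Real.sqrt (-θ σ) ≤ (1 + Real.sqrt M) * ((ℓ σ)⁻¹ + ‖x‖) := by
    have h2 : Real.sqrt (-θ σ) ≤ Real.sqrt M * (ℓ σ)⁻¹ := by
      rw [← div_eq_mul_inv, le_div_iff₀ hℓσ]; exact hgauge
    have h3 : 0 ≤ Real.sqrt M * ‖x‖ := by positivity
    have h4 : 0 ≤ (ℓ σ)⁻¹ := by positivity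
    nlinarith
  have hpos' : 0 < (ℓ σ)⁻¹ + ‖x‖ := by positivity
  calc ‖u (θ σ) x‖ ≤ K / ((ℓ σ)⁻¹ + ‖x‖) := hux
    _ ≤ K * (1 + Real.sqrt M) / (‖x‖ + Real.sqrt (-θ σ)) := by
        rw [div_le_div_iff₀ hpos' hden]
        calc K * (‖x‖ + Real.sqrt (-θ σ)) ≤ K * ((1 + Real.sqrt M) * ((ℓ σ)⁻¹ + ‖x‖)) :=
              mul_le_mul_of_nonneg_left hcmp hK0
          _ = K * (1 + Real.sqrt M) * ((ℓ σ)⁻¹ + ‖x‖) := by ring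

/-- **EVERY DSS FIELD THROUGH THE OBJECT IS TYPE I IN SPACE–TIME** (given the `1/|y|` profile
tail): if `‖W(σ, y)‖ ≤ K/(1 + ‖y‖)`, `c > 1`, and `v` is a globally `c`-DSS field that coincides with
the object on some `(θ(σ₁), 0)`, `σ₁ > σ₀` (e.g. the ancient extension of
`periodicProfile_exists_ancient_dss`), then `HasTypeIDecay C₀ v` for some `C₀` — the tree's
space–time Type-I class of the `rdssClass_*` floors (KNSS 2009 (1.6)), on ALL of `t < 0`
(`periodicProfile_typeI_spaceTime` on the germ, `nsRescale_inv_pow_eq_of_dss_of_agree`,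
`hasTypeIDecay_of_germ`). [cite: KochNadirashviliSereginSverak2009, (1.6)] -/
theorem periodicProfile_hasTypeIDecay (hT : Tendsto θ atTop (𝓝 0)) {K : ℝ}
    (hK : ∀ σ, σ₀ < σ → ∀ y : E, ‖W σ y‖ ≤ K / (1 + ‖y‖)) {c : ℝ} (hc : 1 < c)
    {v : ℝ → E → E} (hv : IsDiscretelySelfSimilar c v) {σ₁ : ℝ} (hσ₁ : σ₀ < σ₁)
    (hvu : ∀ t ∈ Ioo (θ σ₁) 0, v t = u t) : ∃ C₀ : ℝ, HasTypeIDecay C₀ v := by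
  obtain ⟨C₀, hC₀⟩ := periodicProfile_typeI_spaceTime hP hℓ hpos hθ hW hper hperQ hW0 hans hp hu heq hT hK
  have hc0 : 0 < c := zero_lt_one.trans hc
  exact ⟨C₀, hasTypeIDecay_of_germ hc (periodicProfile_time_lt hP hpos hθ hT hσ₁) (hC₀ σ₁ hσ₁)
    (nsRescale_inv_pow_eq_of_dss_of_agree hc0.ne' hv hvu)⟩

end PeriodicProfile

end Summit.NavierStokesRegularity.FluidComputer.SelfSimilarCensus

end
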